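import Summits.Ventures.DiscreteObjects.Hadamard.CyclicCoreDictionary668
import Summits.Ventures.DiscreteObjects.Hadamard.Order167GSQuad668
import Summits.Ventures.DiscreteObjects.Hadamard.InvolutionDet
import Summits.Ventures.DiscreteObjects.Hadamard.Order6Nega

/-!
# H(668): an automorphism of order 222 has a TYPE-I involution part with exactly 224 + 224 fixed points (kernel; structure)

Framing: lottery ticket; floor = certified bounds/negative ranges.

Cell pub-namedobj (venture DiscreteObjects), target (H), hadamard gen 19.  The method of `Order666Excluded668` one level down.
Let `g = (π, κ, d, e)` be a signed automorphism of a Hadamard matrix of order `668` with pair order `222 = 2·3·37`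
(`π^222 = κ^222 = 1`, `(π^111, κ^111)`, `(π^74, κ^74)`, `(π^6, κ^6)` all `≠ (1,1)`).  Then `σ = g²` has pair order `111`, so
(`hadamard668_order111_orbitType`, gen 19) it fixes exactly `2` rows `F` and acts freely with period `111` on the other `666`
(six regular orbits); the involution `ι = g¹¹¹` commutes with `σ`, so the `ι`-fixed `σ`-free rows form a `σ`-stable set on which
`σ` is free: their number is a multiple of `111` (`dvd_card_of_period`); and `ι` permutes the 2-set `F`, fixing `0` or `2` of its
points.  Hence `#Fix π^111 = 111·j + ε`, `ε ∈ {0, 2}`; the involution census (gen 12/13: type I `4 ∣ f`, `4 ≤ f ≤ 332`, type II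
`{0,4}`, type III `0`) leaves `f = 224` (type I) or `f = 0`; and `f = 0` on rows and columns is killed by the order-6 lever
(`hadamard668_aut_order6_cube_fpf` on `h = g³⁷`: `#Fix π^74 ≡ 8 (mod 12)`, while `Fix π^74 = Fix π² ` has `2` elements).  So:
* **`hadamard668_order222_involution_typeI`**: `#Fix π^111 = #Fix κ^111 = 224` — the involution part is of TYPE I (fixing the two
  `σ`-fixed rows and two of the six regular `σ`-orbits pointwise, swapping the other four in pairs; common sign on its fixed
  points by the census), never fixed-point-free.
STRUCTURE only — order `222` is NOT excluded.  H(668) untouched.  Ours; no `sorry`.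
-/

namespace Summit.Ventures.DiscreteObjects.Hadamard

open Finset BigOperators Matrix

open Literature.Combinatorics.Designs.GoethalsSeidel (IsHadamardMatrix)

variable {ι : Type*} [Fintype ι] [DecidableEq ι]

section perm
variable (ρ : Equiv.Perm ι) (hρ : ρ ^ 222 = 1) (h2 : (univ.filter fun i => (ρ ^ 2) i = i).card = 2)
  (hfree : ∀ x, (ρ ^ 2) x ≠ x → ∀ k, 0 < k → k < 111 → ((ρ ^ 2) ^ k) x ≠ x)
include hρ h2 hfree

omit h2 in
/-- the `ρ^111`-fixed, `ρ²`-free points are `111`-divisible in number -/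
lemma dvd_111_card_fixed_free :
    111 ∣ (univ.filter fun i => (ρ ^ 2) i ≠ i ∧ (ρ ^ 111) i = i).card := by
  refine dvd_card_of_period (ρ ^ 2) (by norm_num : 0 < 111) (fun i => (ρ ^ 2) i ≠ i ∧ (ρ ^ 111) i = i) ?_ ?_ ?_ _
    (fun y => by simp)
  · rintro y ⟨hy1, hy2⟩
    refine ⟨fun h => hy1 ((ρ ^ 2).injective h), ?_⟩
    rw [← Equiv.Perm.mul_apply, ← pow_add, show 111 + 2 = 2 + 111 by norm_num, pow_add, Equiv.Perm.mul_apply, hy2]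
  · rintro y -
    rw [← pow_mul, show 2 * 111 = 222 by norm_num, hρ, Equiv.Perm.one_apply]
  · rintro y ⟨hy1, -⟩ dd hdd hlt
    rcases Nat.eq_zero_or_pos dd with rfl | hpos
    · simp at hdd
    · exact hfree y hy1 dd hpos hlt

omit hfree in
/-- `ρ^111` fixes `0` or `2` of the two `ρ²`-fixed points -/
lemma card_fixed_111_on_fixed2 :
    (univ.filter fun i => (ρ ^ 2) i = i ∧ (ρ ^ 111) i = i).card = 0 ∨
    (univ.filter fun i => (ρ ^ 2) i = i ∧ (ρ ^ 111) i = i).card = 2 := by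
  have hsub : (univ.filter fun i => (ρ ^ 2) i = i ∧ (ρ ^ 111) i = i) ⊆ univ.filter fun i => (ρ ^ 2) i = i := by
    intro i hi; rw [Finset.mem_filter] at hi ⊢; exact ⟨hi.1, hi.2.1⟩
  have hle : (univ.filter fun i => (ρ ^ 2) i = i ∧ (ρ ^ 111) i = i).card ≤ 2 := by
    have h := Finset.card_le_card hsub
    rw [h2] at h
    exact h
  -- not exactly one: if u is fixed by ρ² and ρ^111, the other ρ²-fixed point is too
  by_contra hne
  have h1 : (univ.filter fun i => (ρ ^ 2) i = i ∧ (ρ ^ 111) i = i).card = 1 := by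
    obtain ⟨hne0, hne2⟩ := not_or.mp hne
    omega
  obtain ⟨u, hu⟩ := Finset.card_eq_one.mp h1
  have huF : (ρ ^ 2) u = u ∧ (ρ ^ 111) u = u := by
    have : u ∈ univ.filter fun i => (ρ ^ 2) i = i ∧ (ρ ^ 111) i = i := by rw [hu]; exact Finset.mem_singleton_self u
    exact (Finset.mem_filter.mp this).2
  -- the other ρ²-fixed point v
  obtain ⟨v, hvF, hvu⟩ : ∃ v, (ρ ^ 2) v = v ∧ v ≠ u := by
    have h1lt : 1 < (univ.filter fun i => (ρ ^ 2) i = i).card := by rw [h2]; norm_num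
    obtain ⟨a, ha, b, hb, hab⟩ := Finset.one_lt_card.mp h1lt
    simp only [Finset.mem_filter, Finset.mem_univ, true_and] at ha hb
    by_cases hau : a = u
    · exact ⟨b, hb, fun h => hab (hau.trans h.symm)⟩
    · exact ⟨a, ha, hau⟩
  -- ρ^111 v is ρ²-fixed and ≠ u, hence = v … so v is in the singleton filter: contradiction
  have hv' : (ρ ^ 2) ((ρ ^ 111) v) = (ρ ^ 111) v := by
    rw [← Equiv.Perm.mul_apply, ← pow_add, show 2 + 111 = 111 + 2 by norm_num, pow_add, Equiv.Perm.mul_apply, hvF]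
  have hv'u : (ρ ^ 111) v ≠ u := by
    intro h; apply hvu
    have h' : (ρ ^ 111) ((ρ ^ 111) v) = (ρ ^ 111) u := by rw [h]
    rwa [huF.2, ← Equiv.Perm.mul_apply, ← pow_add, hρ, Equiv.Perm.one_apply] at h'
  -- the three points u, v, ρ^111 v are ρ²-fixed; there are only two
  have hv2 : (ρ ^ 111) v = v := by
    by_contra hne'
    have hsub3 : ({u, v, (ρ ^ 111) v} : Finset ι) ⊆ univ.filter fun i => (ρ ^ 2) i = i := by
      intro z hz
      simp only [Finset.mem_insert, Finset.mem_singleton] at hz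
      rw [Finset.mem_filter]
      rcases hz with rfl | rfl | rfl
      · exact ⟨Finset.mem_univ _, huF.1⟩
      · exact ⟨Finset.mem_univ _, hvF⟩
      · exact ⟨Finset.mem_univ _, hv'⟩
    have hcard3 : ({u, v, (ρ ^ 111) v} : Finset ι).card = 3 := by
      rw [Finset.card_insert_of_notMem, Finset.card_insert_of_notMem, Finset.card_singleton]
      · simpa using fun h => hne' h.symm
      · simp only [Finset.mem_insert, Finset.mem_singleton, not_or]
        exact ⟨hvu.symm, hv'u.symm⟩
    have := Finset.card_le_card hsub3
    rw [hcard3, h2] at this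
    omega
  have : v ∈ univ.filter fun i => (ρ ^ 2) i = i ∧ (ρ ^ 111) i = i :=
    Finset.mem_filter.mpr ⟨Finset.mem_univ _, hvF, hv2⟩
  rw [hu, Finset.mem_singleton] at this
  exact hvu this

/-- the fixed count of `ρ^111`: `111·j + ε` with `ε ∈ {0, 2}` -/
lemma card_fixed_111_shape :
    ∃ j ε : ℕ, (ε = 0 ∨ ε = 2) ∧ (univ.filter fun i => (ρ ^ 111) i = i).card = 111 * j + ε := by
  obtain ⟨j, hj⟩ := dvd_111_card_fixed_free ρ hρ hfree
  have hsplit := Finset.card_filter_add_card_filter_not (s := univ.filter fun i => (ρ ^ 111) i = i) (fun i => (ρ ^ 2) i = i)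
  rw [Finset.filter_filter, Finset.filter_filter] at hsplit
  have e1 : (univ.filter fun i => (ρ ^ 111) i = i ∧ (ρ ^ 2) i = i) = univ.filter fun i => (ρ ^ 2) i = i ∧ (ρ ^ 111) i = i := by
    ext i; simp only [Finset.mem_filter, Finset.mem_univ, true_and]; exact and_comm
  have e2 : (univ.filter fun i => (ρ ^ 111) i = i ∧ ¬ (ρ ^ 2) i = i) =
      univ.filter fun i => (ρ ^ 2) i ≠ i ∧ (ρ ^ 111) i = i := by
    ext i; simp only [Finset.mem_filter, Finset.mem_univ, true_and]; exact and_comm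
  rw [e1, e2, hj] at hsplit
  rcases card_fixed_111_on_fixed2 ρ hρ h2 with h0 | h0
  · exact ⟨j, 0, Or.inl rfl, by omega⟩
  · exact ⟨j, 2, Or.inr rfl, by omega⟩

omit [Fintype ι] hρ h2 in
/-- `Fix ρ^74 = Fix ρ²` pointwise (free rows have period `111 > 37`) -/
lemma fixed_74_iff (x : ι) : (ρ ^ 74) x = x ↔ (ρ ^ 2) x = x := by
  constructor
  · intro h
    by_contra hne
    exact hfree x hne 37 (by norm_num) (by norm_num) (by rw [← pow_mul]; exact h)
  · intro h
    rw [show (74 : ℕ) = 2 * 37 by norm_num, pow_mul]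
    exact perm_pow_apply_of_fixed _ h 37

end perm

section main
variable {H : Matrix ι ι ℤ}

omit [Fintype ι] [DecidableEq ι] in
/-- pointwise sixth power of `ρ^37` from `ρ^222 = 1` -/
private lemma pow37_six (ρ : Equiv.Perm ι) (hρ : ρ ^ 222 = 1) (i : ι) :
    (ρ ^ 37) ((ρ ^ 37) ((ρ ^ 37) ((ρ ^ 37) ((ρ ^ 37) ((ρ ^ 37) i))))) = i := by
  rw [← Equiv.Perm.mul_apply, ← Equiv.Perm.mul_apply, ← Equiv.Perm.mul_apply, ← Equiv.Perm.mul_apply,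
    ← Equiv.Perm.mul_apply, ← pow_add, ← pow_add, ← pow_add, ← pow_add, ← pow_add]
  show (ρ ^ 222) i = i
  rw [hρ, Equiv.Perm.one_apply]

omit [Fintype ι] [DecidableEq ι] in
/-- pointwise cube of `ρ^37` -/
private lemma pow37_three (ρ : Equiv.Perm ι) (i : ι) : (ρ ^ 37) ((ρ ^ 37) ((ρ ^ 37) i)) = (ρ ^ 111) i := by
  rw [← Equiv.Perm.mul_apply, ← Equiv.Perm.mul_apply, ← pow_add, ← pow_add]

omit [Fintype ι] [DecidableEq ι] in
/-- pointwise square of `ρ^37` -/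
private lemma pow37_two (ρ : Equiv.Perm ι) (i : ι) : (ρ ^ 37) ((ρ ^ 37) i) = (ρ ^ 74) i := by
  rw [← Equiv.Perm.mul_apply, ← pow_add]

/-- **Order 222: the involution part is of type I with `224 + 224` fixed points.** -/
theorem hadamard668_order222_involution_typeI (hH : IsHadamardMatrix H) (hι : Fintype.card ι = 668)
    (π κ : Equiv.Perm ι) (d e : ι → ℤ) (haut : IsSignedAut H π κ d e)
    (hπ : π ^ 222 = 1) (hκ : κ ^ 222 = 1) (h111 : π ^ 111 ≠ 1 ∨ κ ^ 111 ≠ 1)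
    (h74 : π ^ 74 ≠ 1 ∨ κ ^ 74 ≠ 1) (h6 : π ^ 6 ≠ 1 ∨ κ ^ 6 ≠ 1) :
    (univ.filter fun i => (π ^ 111) i = i).card = 224 ∧ (univ.filter fun j => (κ ^ 111) j = j).card = 224 := by
  -- σ = g² has pair order 111
  have hσπ : (π ^ 2) ^ 111 = 1 := by rw [← pow_mul]; exact hπ
  have hσκ : (κ ^ 2) ^ 111 = 1 := by rw [← pow_mul]; exact hκ
  have h37 : (π ^ 2) ^ 37 ≠ 1 ∨ (κ ^ 2) ^ 37 ≠ 1 := by rw [← pow_mul, ← pow_mul]; exact h74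
  have h3 : (π ^ 2) ^ 3 ≠ 1 ∨ (κ ^ 2) ^ 3 ≠ 1 := by rw [← pow_mul, ← pow_mul]; exact h6
  obtain ⟨⟨hR2, hRfree⟩, hC2, hCfree⟩ :=
    hadamard668_order111_orbitType hH hι (π ^ 2) (κ ^ 2) _ _ (isSignedAut_pow haut 2) hσπ hσκ h37 h3
  -- ι = g^111
  have hιπ : (π ^ 111) ^ 2 = 1 := by rw [← pow_mul]; exact hπ
  have hικ : (κ ^ 111) ^ 2 = 1 := by rw [← pow_mul]; exact hκ
  have hautι := isSignedAut_pow haut 111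
  obtain ⟨-, -, hcases⟩ := hadamard668_involution_census hH hι (π ^ 111) (κ ^ 111) _ _ hautι hιπ hικ h111
  obtain ⟨jR, εR, hεR, hfR⟩ := card_fixed_111_shape π hπ hR2 hRfree
  obtain ⟨jC, εC, hεC, hfC⟩ := card_fixed_111_shape κ hκ hC2 hCfree
  rw [hfR, hfC] at hcases
  -- the fixed-point-free case is impossible (order-6 lever on h = g^37)
  have hnot0 : ¬ ((univ.filter fun i => (π ^ 111) i = i).card = 0 ∧ (univ.filter fun j => (κ ^ 111) j = j).card = 0) := by
    rintro ⟨h0R, h0C⟩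
    have hπfpf : ∀ i, (π ^ 111) i ≠ i := moved_of_card_fixed_eq_zero _ h0R
    have hκfpf : ∀ j, (κ ^ 111) j ≠ j := moved_of_card_fixed_eq_zero _ h0C
    obtain ⟨-, -, hmod, -⟩ := hadamard668_aut_order6_cube_fpf hH hι (isSignedAut_pow haut 37) (pow37_six π hπ)
      (pow37_six κ hκ) (fun i h => hπfpf i (by rw [← pow37_three]; exact h))
      (fun j h => hκfpf j (by rw [← pow37_three]; exact h))
    have hF : (univ.filter fun i => (π ^ 37) ((π ^ 37) i) = i) = univ.filter fun i => (π ^ 2) i = i := by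
      ext i
      simp only [Finset.mem_filter, Finset.mem_univ, true_and, pow37_two]
      exact fixed_74_iff π hRfree i
    rw [hF, hR2] at hmod
    norm_num at hmod
  rw [hfR, hfC] at hnot0
  rcases hcases with ⟨heq, -, h2le, hle, -⟩ | ⟨h0, h4, -⟩ | ⟨h4, h0, -⟩ | ⟨h0, h0'⟩
  · -- type I: 4 ∣ f with a fixed row and column
    have hr : ∃ i, (π ^ 111) i = i := by
      have hpos : 0 < (univ.filter fun i => (π ^ 111) i = i).card := by rw [hfR]; omega
      obtain ⟨i, hi⟩ := Finset.card_pos.mp hpos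
      exact ⟨i, (Finset.mem_filter.mp hi).2⟩
    have hc : ∃ j, (κ ^ 111) j = j := by
      have hpos : 0 < (univ.filter fun j => (κ ^ 111) j = j).card := by rw [hfC]; omega
      obtain ⟨j, hj⟩ := Finset.card_pos.mp hpos
      exact ⟨j, (Finset.mem_filter.mp hj).2⟩
    obtain ⟨h4, -, -, -⟩ := hadamard668_involution_typeI_mod4 hH hι (π ^ 111) (κ ^ 111) _ _ hautι hιπ hικ h111 hr hc
    rw [hfR] at h4
    have hjR : jR = 2 ∧ εR = 2 := by
      rcases hεR with rfl | rfl <;> omega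
    obtain ⟨rfl, rfl⟩ := hjR
    refine ⟨by rw [hfR], by rw [hfC]; omega⟩
  · exfalso; rcases hεC with rfl | rfl <;> omega
  · exfalso; rcases hεR with rfl | rfl <;> omega
  · exact absurd ⟨h0, h0'⟩ hnot0

end main

end Summit.Ventures.DiscreteObjects.Hadamard
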